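import Summits.KontsevichZagierPeriods.Zeta5Search.SymRayZudilin15
import Summits.KontsevichZagierPeriods.Zeta5Search.WedgeDictionaryCorner
import HarnessLib

/-!
# The `Q`-part of `wedgeDictionary` on the diagonal `a = n·1⁸`, literally (cell `pub-zeta5`, P1)

HONEST FRAMING: systematic search; no irrationality claim unless certified.

OUR work (Summit side), P1 seat generation 3. `SymRayZudilin15.bz_Q_ray` gives Brown–Zudilin's totally symmetric `Q_n`
(double binomial sum (7)) as the wedge square on the ray `b_n = (3n;n⁷)`. Here we rewrite it LITERALLY in the vocabulary of the
conjecture `WedgeDictionary.wedgeDictionary` at `a = n·1⁸ = (n,…,n)`: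
* `bOfA_diag`: `b(n·1⁸) = bRay n`; `rhoOf_diag`: `ρ(n·1⁸) = (−1)ⁿ n!¹⁰/(4(2n)!)`;
* `QOf_diag`: the general leading coefficient (17) at `a = n·1⁸` IS the symmetric sum (7): `QOf (n·1⁸) = Q_n` (re-indexing `k_i = n + i`);
* **`wedgeDictionary_Q_diag`**: `Q(a) = ρ(a)·(U(b)W(b') − U(b')W(b))` with `b = b(a)`, `b' = b + e₁`, for every `a = n·1⁸`, `n ≥ 0` —
  the first conjunct of the conjecture on the whole diagonal (previously kernel instances `n = 1, 2`).
-/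

noncomputable section

open Finset

namespace Summit.KontsevichZagierPeriods.Zeta5Search.SymRay

open Summit.KontsevichZagierPeriods.Zeta5Search.WedgeDictionary
open Literature.NumberTheory.Irrationality
open Literature.NumberTheory.Irrationality.BrownZudilin2022 (bOfA QOf Qcoeff pOf qOf zchoose)

/-- The diagonal vector `a = n·1⁸`. -/
def aDiag (n : ℕ) : Fin 8 → ℤ := fun _ => (n : ℤ)

/-- `b(n·1⁸) = (3n; n⁷) = bRay n`. -/
theorem bOfA_diag (n : ℕ) : bOfA (aDiag n) = bRay n := by
  funext j
  match j with
  | 0 => simp [bOfA, aDiag, bRay]; ring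
  | 1 => simp [bOfA, aDiag, bRay]
  | 2 => simp [bOfA, aDiag, bRay]
  | 3 => simp [bOfA, aDiag, bRay]
  | 4 => simp [bOfA, aDiag, bRay]
  | 5 => simp [bOfA, aDiag, bRay]
  | 6 => simp [bOfA, aDiag, bRay]
  | 7 => simp [bOfA, aDiag, bRay]
  | k + 8 => simp [bOfA, bRay]

/-- The partner `b + e₁` of `b(n·1⁸)` is `bRay' n`. -/
theorem update_bOfA_diag (n : ℕ) : Function.update (bOfA (aDiag n)) 1 (bOfA (aDiag n) 1 + 1) = bRay' n := by
  rw [bOfA_diag]; rfl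

/-- `p(n·1⁸) = (n, n, n, 2n, n, n, n)`. -/
theorem pOf_diag (n : ℕ) : pOf (aDiag n) = ![(n : ℤ), n, n, 2 * n, n, n, n] := by
  ext i; fin_cases i <;> (simp [pOf, aDiag]; try ring)

/-- `q(n·1⁸) = (n, n, n, n, n)`. -/
theorem qOf_diag (n : ℕ) : qOf (aDiag n) = ![(n : ℤ), n, n, n, n] := by
  ext i; fin_cases i <;> simp [qOf, aDiag]

/-- `zchoose` at natural arguments in range. -/
theorem zchoose_natCast (m k : ℕ) (h : k ≤ m) : zchoose (m : ℤ) (k : ℤ) = (m.choose k : ℤ) := by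
  simp [zchoose, h]

/-- Re-indexing an integer interval sum: `Σ_{k ∈ [n, 2n]} F k = Σ_{i ≤ n} F (n + i)`. -/
theorem sum_Icc_shift (n : ℕ) (F : ℤ → ℤ) :
    ∑ k ∈ Icc (n : ℤ) (n + n), F k = ∑ i ∈ range (n + 1), F ((n : ℤ) + i) := by
  refine sum_nbij' (fun k => (k - n).toNat) (fun i => (n : ℤ) + i) ?_ ?_ ?_ ?_ ?_
  · intro k hk; rw [mem_Icc] at hk; rw [mem_range]; omega
  · intro i hi; rw [mem_range] at hi; rw [mem_Icc]; omega
  · intro k hk; rw [mem_Icc] at hk; omega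
  · intro i _; simp
  · intro k hk; rw [mem_Icc] at hk; congr 1; omega

/-- **(17) at `a = n·1⁸` is the totally symmetric sum (7)**: `QOf (n·1⁸) = Q_n`. -/
theorem QOf_diag (n : ℕ) : QOf (aDiag n) = (BrownZudilin2022.Q n : ℤ) := by
  unfold QOf Qcoeff
  rw [pOf_diag, qOf_diag]
  simp only [Matrix.cons_val_zero, Matrix.cons_val_one, Matrix.cons_val, Fin.sum_univ_seven]
  have hsign : ((n : ℤ) + n + n + 2 * n + n + n + n).toNat = 2 * (4 * n) := by
    rw [show (n : ℤ) + n + n + 2 * n + n + n + n = ((2 * (4 * n) : ℕ) : ℤ) by push_cast; ring, Int.toNat_natCast]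
  rw [hsign, pow_mul, neg_one_sq, one_pow, one_mul, BrownZudilin2022.Q]
  push_cast
  rw [sum_Icc_shift]
  refine sum_congr rfl fun i hi => ?_
  rw [sum_Icc_shift]
  refine sum_congr rfl fun j hj => ?_
  have hi' := mem_range.1 hi
  have hj' := mem_range.1 hj
  rw [show (n : ℤ) + i + ((n : ℤ) + j) + n - n - n = ((n + i + j : ℕ) : ℤ) by push_cast; ring,
    show (2 * (n : ℤ) + n - n - n) = ((n : ℕ) : ℤ) by ring, show (n : ℤ) + i - n = ((i : ℕ) : ℤ) by ring,
    show (n : ℤ) + j - n = ((j : ℕ) : ℤ) by ring, show (n : ℤ) + i = ((n + i : ℕ) : ℤ) by push_cast; ring,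
    show (n : ℤ) + j = ((n + j : ℕ) : ℤ) by push_cast; ring,
    zchoose_natCast _ _ (by omega), zchoose_natCast _ _ (by omega), zchoose_natCast _ _ (by omega),
    zchoose_natCast _ _ (by omega), zchoose_natCast _ _ (by omega)]
  ring

/-- `ρ(n·1⁸) = (−1)ⁿ n!¹⁰/(4·(2n)!)` (fifteen pair factorials `n!`, five single `n!`, `d! = (2n)!`, sign `(−1)^{7n}`). -/
theorem rhoOf_diag (n : ℕ) :
    rhoOf (aDiag n) = (-1) ^ n * (n.factorial : ℚ) ^ 10 / (4 * ((2 * n).factorial : ℚ)) := by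
  unfold rhoOf
  simp only [bOfA_diag, dOf_bRay, Epairs, List.map_cons, List.map_nil, List.prod_cons, List.prod_nil, bRay_zero]
  have hb : ∀ j : ℕ, j ∈ [1, 2, 3, 4, 5, 6, 7] → bRay n j = n := fun j hj => by
    simp only [List.mem_cons, List.not_mem_nil, or_false] at hj
    rcases hj with rfl | rfl | rfl | rfl | rfl | rfl | rfl <;> simp [bRay]
  rw [hb 1 (by simp), hb 2 (by simp), hb 3 (by simp), hb 4 (by simp), hb 5 (by simp), hb 6 (by simp), hb 7 (by simp),
    sum_bRay]
  rw [show (3 * (n : ℤ) - n - n).toNat = n by rw [show 3 * (n : ℤ) - n - n = (n : ℤ) by ring, Int.toNat_natCast],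
    show (7 * (n : ℤ)).toNat = 7 * n by rw [show 7 * (n : ℤ) = ((7 * n : ℕ) : ℤ) by push_cast; ring, Int.toNat_natCast],
    show (2 * (n : ℤ)).toNat = 2 * n by rw [show 2 * (n : ℤ) = ((2 * n : ℕ) : ℤ) by push_cast; ring, Int.toNat_natCast],
    Int.toNat_natCast]
  have hs : ((-1 : ℚ)) ^ (7 * n) = (-1) ^ n := by
    rw [show 7 * n = n + 2 * (3 * n) by ring, pow_add, pow_mul, neg_one_sq, one_pow, mul_one]
  rw [hs]
  have hf : ((2 * n).factorial : ℚ) ≠ 0 := by positivity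
  have hn : (n.factorial : ℚ) ≠ 0 := by positivity
  field_simp

/-- **The `Q`-part of `wedgeDictionary` on the whole diagonal `a = n·1⁸`** (partner `j = 1`), literally:
`Q(a) = ρ(a)·(U(b)·W(b + e₁) − U(b + e₁)·W(b))` with `b = b(a)`. -/
theorem wedgeDictionary_Q_diag (n : ℕ) :
    (QOf (aDiag n) : ℚ) = rhoOf (aDiag n) *
      (coeffU (bOfA (aDiag n)) * coeffW (Function.update (bOfA (aDiag n)) 1 (bOfA (aDiag n) 1 + 1)) -
        coeffU (Function.update (bOfA (aDiag n)) 1 (bOfA (aDiag n) 1 + 1)) * coeffW (bOfA (aDiag n))) := by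
  rw [update_bOfA_diag, bOfA_diag, QOf_diag, rhoOf_diag]
  push_cast
  exact bz_Q_ray n

end Summit.KontsevichZagierPeriods.Zeta5Search.SymRay
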